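import Mathlib
import Summits.Ventures.PercRepro2.RowC1AvoidTower

/-!
# The `b`-avoiding attraction: `b ∈ C₂` and «`o` joined to `a₂` avoiding `b`» are positively
correlated given `a₁ ↮ a₂` (blind cell PercRepro2, p2 g29; proofs/P2-G29-E1.md §2, Lemma 1, part 3 of 3)

With `Q = {a₁ ↮ a₂}`, `K = C_{G−b}(a₂)` and `o ∈ K` = `avoidConnEvent ends b a₂ o`, for `a₂ ≠ b`:

  **`bH_avoidK_attract`**: `P(Q, b ∈ C₂) · P(Q, o ∈ K) ≤ P(Q, b ∈ C₂, o ∈ K) · P(Q)`.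

Proof (BHK06 on `G − b`): percolation on `G[V ∖ {b}]` is the configuration with the edges at `b`
closed (`induced_erase_eq_delConfig`), so the cluster of `a₂` in `G[V ∖ {b}]` is `K` and
`R^{V∖{b}}_{a₁} = {a₁ ∉ K}`.  The tower identities of `RowC1AvoidTower.lean` write the four masses as
`E[σζ(K) 1_{a₁∉K}]`, `E[σζ(K) 1_{o∈K} 1_{a₁∉K}]`, `E[(ρ + σζ)(K) 1_{a₁∉K}]`,
`E[(ρ + σζ)(K) 1_{o∈K} 1_{a₁∉K}]`; `bhk_induced` (BHK06 Thm 1.1, functional form, `BHK.lean`) for the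
increasing functionals `σ ζ` and `σ` against `1_{o ∈ ·}` gives `A · Pc ≤ B · P` and `S · Pc ≤ T · P`
(notation in the proof), and with `ρ = 1 − σ` two lines of algebra finish (the case `P(a₁ ∉ K) = 0`
separately).  This is the K-side attraction of the exact identity for (E1′) (proofs/P2-G29-E1.md §1 (b)).
-/

namespace Summit.Ventures.PercRepro2

namespace RowC1

section Main

variable {V : Type*} {E : Type*} [Fintype E] [DecidableEq E] [Fintype V] [DecidableEq V]
  {R : Type*} [CommRing R] [LinearOrder R] [IsStrictOrderedRing R]

omit [Fintype E] [DecidableEq E] [LinearOrder R] [IsStrictOrderedRing R] in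
/-- Percolation on `G[V ∖ {b}]` is the configuration with every edge at `b` closed. -/
lemma induced_erase_eq_delConfig (ends : E → Sym2 V) (b : V) (ω : Config E) :
    induced ends (↑(Finset.univ.erase b) : Set V) ω = delConfig ends {b} ω := by
  funext e
  by_cases hb : e ∈ touches ends {b}
  · rw [delConfig_apply_of_mem hb]
    obtain ⟨z, hz, z', hzz'⟩ := hb
    rw [Set.mem_singleton_iff] at hz
    subst hz
    have : e ∉ within ends (↑(Finset.univ.erase z) : Set V) := by
      rintro ⟨x, hx, y, hy, hxy⟩
      rw [hzz', Sym2.eq_iff] at hxy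
      rcases hxy with ⟨hxz, -⟩ | ⟨hyz, -⟩
      · exact (Finset.mem_erase.1 (Finset.mem_coe.1 hx)).1 hxz.symm
      · exact (Finset.mem_erase.1 (Finset.mem_coe.1 hy)).1 hyz.symm
    cases h : induced ends (↑(Finset.univ.erase z) : Set V) ω e
    · rfl
    · exact absurd (induced_eq_true_iff.1 h).2 this
  · rw [delConfig_apply_of_notMem hb]
    obtain ⟨⟨x, y⟩, hxy⟩ := Quot.exists_rep (ends e)
    have hends : ends e = s(x, y) := hxy.symm
    have hx : x ≠ b := fun h => hb (mem_touches_of_ends hends (Or.inl (h ▸ rfl)))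
    have hy : y ≠ b := fun h => hb (mem_touches_of_ends hends (Or.inr (h ▸ rfl)))
    have : e ∈ within ends (↑(Finset.univ.erase b) : Set V) :=
      ⟨x, Finset.mem_coe.2 (Finset.mem_erase.2 ⟨hx, Finset.mem_univ _⟩),
        y, Finset.mem_coe.2 (Finset.mem_erase.2 ⟨hy, Finset.mem_univ _⟩), hends⟩
    cases hω : ω e
    · have hle := induced_le (ends := ends) (↑(Finset.univ.erase b) : Set V) ω e
      rw [hω] at hle
      cases h : induced ends (↑(Finset.univ.erase b) : Set V) ω e
      · rfl
      · rw [h] at hle; exact absurd hle (not_le_of_gt Bool.false_lt_true)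
    · exact induced_eq_true_iff.2 ⟨hω, this⟩

omit [Fintype E] [DecidableEq E] [LinearOrder R] [IsStrictOrderedRing R] in
/-- The cluster of `a₂` in `G[V ∖ {b}]` is `K`. -/
lemma clusterIn_erase_eq (ends : E → Sym2 V) (b a₂ : V) (ω : Config E) :
    clusterIn ends (Finset.univ.erase b) a₂ ω = avoidCluster ends b a₂ ω := by
  unfold clusterIn avoidCluster
  rw [induced_erase_eq_delConfig]

omit [Fintype E] [DecidableEq E] [LinearOrder R] [IsStrictOrderedRing R] in
/-- `1_{R^U_{a₁}}(ω) = 1[a₁ ∉ K(ω)]`. -/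
lemma REvent_indicator_eq (ends : E → Sym2 V) (a₁ a₂ b : V) (ω : Config E) :
    (REvent ends (Finset.univ.erase b) a₂ {a₁}).indicator (1 : Config E → R) ω =
      ({W : Set V | a₁ ∉ W} : Set (Set V)).indicator 1 (avoidCluster ends b a₂ ω) := by
  have hmem : ω ∈ REvent ends (Finset.univ.erase b) a₂ {a₁} ↔
      a₁ ∉ avoidCluster ends b a₂ ω := by
    rw [mem_REvent]
    simp only [Finset.mem_singleton, forall_eq, avoidCluster, mem_cluster,
      induced_erase_eq_delConfig]
  by_cases h : a₁ ∈ avoidCluster ends b a₂ ω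
  · rw [Set.indicator_of_notMem (fun h' => (hmem.1 h') h),
      Set.indicator_of_notMem (show avoidCluster ends b a₂ ω ∉ {W : Set V | a₁ ∉ W} from
        fun h' => h' h)]
  · rw [Set.indicator_of_mem (hmem.2 h), Set.indicator_of_mem (show avoidCluster ends b a₂ ω ∈
      {W : Set V | a₁ ∉ W} from h)]
    rfl

/-- **The `b`-avoiding attraction** (BHK06 on `G − b`): for `a₂ ≠ b`,
`P(Q, b ∈ C₂) · P(Q, o ∈ K) ≤ P(Q, b ∈ C₂, o ∈ K) · P(Q)`, where `Q = {a₁ ↮ a₂}` and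
`o ∈ K` = `o` joined to `a₂` avoiding `b`. -/
theorem bH_avoidK_attract (p : E → R) (hp : IsProbVec p) (ends : E → Sym2 V) (a₁ a₂ o b : V)
    (hne : a₂ ≠ b) :
    prob p (connEvent ends a₂ b ∩ (connEvent ends a₁ a₂)ᶜ) *
        prob p (avoidConnEvent ends b a₂ o ∩ (connEvent ends a₁ a₂)ᶜ) ≤
      prob p (connEvent ends a₂ b ∩ avoidConnEvent ends b a₂ o ∩ (connEvent ends a₁ a₂)ᶜ) *
        prob p (connEvent ends a₁ a₂)ᶜ := by
  classical
  -- the degenerate case `a₁ = b`: `{b ∈ C₂} ∩ Q = ∅`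
  by_cases hab : a₁ = b
  · subst hab
    have h0 : connEvent ends a₂ a₁ ∩ (connEvent ends a₁ a₂)ᶜ = ∅ := by
      ext ω
      simp only [Set.mem_inter_iff, Set.mem_compl_iff, mem_connEvent, Set.mem_empty_iff_false,
        iff_false, not_and, not_not]
      exact fun h => conn_symm h
    rw [h0, prob_empty, zero_mul]
    exact mul_nonneg (prob_nonneg hp _) (prob_nonneg hp _)
  set K : Config E → Set V := fun ω => avoidCluster ends b a₂ ω with hK
  set D : Set (Set V) := {W | a₁ ∉ W} with hD
  set C : Set (Set V) := {W | o ∈ W} with hC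
  set σ : Set V → R := attachProb p ends b with hσ
  set ρ : Set V → R := noAttachProb p ends b with hρ
  set ζ : Set V → R := delAvoidProb p ends b a₁ with hζ
  -- the events `{o ∈ K}` and `{K ∈ C}` agree, `{K ∈ univ}` is everything
  have hoK : avoidConnEvent ends b a₂ o = {ω | K ω ∈ C} := by
    ext ω; rfl
  have huniv : ({ω | K ω ∈ (Set.univ : Set (Set V))} : Set (Config E)) = Set.univ := by
    ext ω; simp
  -- the four masses as expectations (tower identities)
  have m1 : prob p (connEvent ends a₂ b ∩ (connEvent ends a₁ a₂)ᶜ) =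
      expect p (fun ω => σ (K ω) * ζ (K ω) * D.indicator 1 (K ω)) := by
    rw [← Set.inter_univ (connEvent ends a₂ b ∩ (connEvent ends a₁ a₂)ᶜ), ← huniv,
      prob_bH_Q_eq_expect p ends a₁ a₂ b hne Set.univ]
    refine congrArg _ (funext fun ω => ?_)
    simp only [coeffK, Set.indicator_univ, Pi.one_apply, one_mul]
    ring
  have m2 : prob p (connEvent ends a₂ b ∩ avoidConnEvent ends b a₂ o ∩ (connEvent ends a₁ a₂)ᶜ) =
      expect p (fun ω => σ (K ω) * ζ (K ω) * C.indicator 1 (K ω) * D.indicator 1 (K ω)) := by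
    rw [hoK, Set.inter_right_comm, prob_bH_Q_eq_expect p ends a₁ a₂ b hne C]
    refine congrArg _ (funext fun ω => ?_)
    simp only [coeffK]
    ring
  have m3 : prob p (connEvent ends a₁ a₂)ᶜ =
      expect p (fun ω => (ρ (K ω) + σ (K ω) * ζ (K ω)) * D.indicator 1 (K ω)) := by
    rw [← Set.inter_univ (connEvent ends a₁ a₂)ᶜ, ← huniv,
      prob_Q_eq_expect p ends a₁ a₂ b hne Set.univ]
    refine congrArg _ (funext fun ω => ?_)
    simp only [coeffK, Set.indicator_univ, Pi.one_apply, one_mul]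
    ring
  have m4 : prob p (avoidConnEvent ends b a₂ o ∩ (connEvent ends a₁ a₂)ᶜ) =
      expect p (fun ω => (ρ (K ω) + σ (K ω) * ζ (K ω)) * C.indicator 1 (K ω) *
        D.indicator 1 (K ω)) := by
    rw [hoK, Set.inter_comm, prob_Q_eq_expect p ends a₁ a₂ b hne C]
    refine congrArg _ (funext fun ω => ?_)
    simp only [coeffK]
    ring
  -- the functionals
  have hσmono : Monotone σ := fun W W' h => prob_mono hp (attachEvent_mono b h)
  have hζmono : Monotone ζ := fun W W' h => prob_mono hp (delAvoidEvent_mono b a₁ h)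
  have hσ0 : ∀ W, 0 ≤ σ W := fun W => prob_nonneg hp _
  have hζ0 : ∀ W, 0 ≤ ζ W := fun W => prob_nonneg hp _
  have hσ1 : ∀ W, σ W ≤ 1 := fun W => prob_le_one hp _
  have hζ1 : ∀ W, ζ W ≤ 1 := fun W => prob_le_one hp _
  have hρ : ∀ W, ρ W = 1 - σ W := fun W => prob_compl p _
  have hF₁mono : Monotone (fun W => σ W * ζ W) := fun W W' h =>
    mul_le_mul (hσmono h) (hζmono h) (hζ0 W) (hσ0 W')
  have hF₁0 : ∀ W, 0 ≤ σ W * ζ W := fun W => mul_nonneg (hσ0 W) (hζ0 W)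
  have hF₁1 : ∀ W, σ W * ζ W ≤ 1 := fun W => mul_le_one₀ (hσ1 W) (hζ0 W) (hζ1 W)
  have hCup : IsUpperSet C := fun W W' h hW => h hW
  have hF₂mono : Monotone (C.indicator (1 : Set V → R)) :=
    monotone_indicator_one_of_isUpperSet (R := R) hCup
  have hF₂0 : ∀ W, 0 ≤ C.indicator (1 : Set V → R) W :=
    fun W => Set.indicator_apply_nonneg fun _ => zero_le_one
  have hD0 : ∀ W, 0 ≤ D.indicator (1 : Set V → R) W :=
    fun W => Set.indicator_apply_nonneg fun _ => zero_le_one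
  -- the two BHK inequalities on `G[V ∖ {b}]`
  have hsub : ({a₁} : Finset V) ⊆ Finset.univ.erase b := by
    intro x hx
    rw [Finset.mem_singleton] at hx
    subst hx
    exact Finset.mem_erase.2 ⟨hab, Finset.mem_univ _⟩
  have key1 := bhk_induced p hp ends a₂ hF₁mono hF₂mono hF₁0 hF₂0 (Finset.univ.erase b) {a₁} {a₁}
    hsub hsub
  have key2 := bhk_induced p hp ends a₂ hσmono hF₂mono hσ0 hF₂0 (Finset.univ.erase b) {a₁} {a₁}
    hsub hsub
  simp only [Finset.inter_self, Finset.union_self] at key1 key2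
  -- the integrands in terms of `K`
  have e1 : ∀ F : Set V → R, (clusterObs ends (Finset.univ.erase b) a₂ F *
      (REvent ends (Finset.univ.erase b) a₂ {a₁}).indicator 1 : Config E → R) =
      fun ω => F (K ω) * D.indicator 1 (K ω) := by
    intro F
    funext ω
    simp only [Pi.mul_apply, clusterObs_apply, clusterIn_erase_eq, REvent_indicator_eq]
    rfl
  have e2 : prob p (REvent ends (Finset.univ.erase b) a₂ {a₁}) =
      expect p (fun ω => D.indicator 1 (K ω)) := by
    rw [prob_eq_expect_indicator]
    exact congrArg _ (funext fun ω => REvent_indicator_eq ends a₁ a₂ b ω)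
  rw [e1, e1, e1, e2] at key1 key2
  simp only [Pi.mul_apply] at key1 key2
  -- atomic expectations
  set A := expect p (fun ω => σ (K ω) * ζ (K ω) * D.indicator 1 (K ω)) with hA
  set B := expect p (fun ω => σ (K ω) * ζ (K ω) * C.indicator 1 (K ω) * D.indicator 1 (K ω)) with hB
  set S := expect p (fun ω => σ (K ω) * D.indicator 1 (K ω)) with hS
  set T := expect p (fun ω => σ (K ω) * C.indicator 1 (K ω) * D.indicator 1 (K ω)) with hT
  set P := expect p (fun ω => D.indicator 1 (K ω)) with hP
  set Pc := expect p (fun ω => C.indicator 1 (K ω) * D.indicator 1 (K ω)) with hPc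
  have hm3 : prob p (connEvent ends a₁ a₂)ᶜ = (P - S) + A := by
    rw [m3, hP, hS, hA, ← expect_sub, ← expect_add]
    refine congrArg _ (funext fun ω => ?_)
    simp only [Pi.add_apply, Pi.sub_apply, hρ]
    ring
  have hm4 : prob p (avoidConnEvent ends b a₂ o ∩ (connEvent ends a₁ a₂)ᶜ) = (Pc - T) + B := by
    rw [m4, hPc, hT, hB, ← expect_sub, ← expect_add]
    refine congrArg _ (funext fun ω => ?_)
    simp only [Pi.add_apply, Pi.sub_apply, hρ]
    ring
  rw [m1, m2, hm3, hm4]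
  -- nonnegativity and domination
  have hA0 : 0 ≤ A := expect_nonneg hp fun ω => mul_nonneg (hF₁0 _) (hD0 _)
  have hB0 : 0 ≤ B := expect_nonneg hp fun ω =>
    mul_nonneg (mul_nonneg (hF₁0 _) (hF₂0 _)) (hD0 _)
  have hP0 : 0 ≤ P := expect_nonneg hp fun ω => hD0 _
  have hAP : A ≤ P := expect_mono hp fun ω => mul_le_of_le_one_left (hD0 _) (hF₁1 _)
  have hSP : S ≤ P := expect_mono hp fun ω => mul_le_of_le_one_left (hD0 _) (hσ1 _)
  have hTPc : T ≤ Pc := expect_mono hp fun ω => by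
    rw [mul_assoc]
    exact mul_le_of_le_one_left (mul_nonneg (hF₂0 _) (hD0 _)) (hσ1 _)
  -- goal: `A * ((Pc - T) + B) ≤ B * ((P - S) + A)`, i.e. `A * (Pc - T) ≤ B * (P - S)`
  have hgoal : A * (Pc - T) ≤ B * (P - S) := by
    rcases hP0.eq_or_lt with hP0' | hPpos
    · have hA0' : A = 0 := le_antisymm (hP0' ▸ hAP) hA0
      rw [hA0', zero_mul]
      exact mul_nonneg hB0 (sub_nonneg.2 hSP)
    · have h1 : A * Pc ≤ B * P := key1
      have h2 : S * Pc ≤ T * P := key2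
      have h3 : A * (Pc - T) * P ≤ B * (P - S) * P := by
        nlinarith [mul_le_mul_of_nonneg_left h2 hA0, mul_le_mul_of_nonneg_left h1 (sub_nonneg.2 hSP)]
      exact le_of_mul_le_mul_right h3 hPpos
  nlinarith [hgoal]

/-- **The mirror** (`bH_avoidK_attract` with the roots exchanged): for `a₁ ≠ b`,
`P(Q, b ∈ C₁) · P(Q, o ∈ K₁) ≤ P(Q, b ∈ C₁, o ∈ K₁) · P(Q)`, where `o ∈ K₁` = `o` joined to `a₁`
avoiding `b`. -/
theorem bL_avoidK1_attract (p : E → R) (hp : IsProbVec p) (ends : E → Sym2 V) (a₁ a₂ o b : V)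
    (hne : a₁ ≠ b) :
    prob p (connEvent ends a₁ b ∩ (connEvent ends a₁ a₂)ᶜ) *
        prob p (avoidConnEvent ends b a₁ o ∩ (connEvent ends a₁ a₂)ᶜ) ≤
      prob p (connEvent ends a₁ b ∩ avoidConnEvent ends b a₁ o ∩ (connEvent ends a₁ a₂)ᶜ) *
        prob p (connEvent ends a₁ a₂)ᶜ := by
  have h := bH_avoidK_attract p hp ends a₂ a₁ o b hne
  rwa [connEvent_comm ends a₂ a₁] at h

end Main
end RowC1

end Summit.Ventures.PercRepro2
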